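import Summits.AtomisticToContinuum.BoseEinsteinCondensation.Theorems.BECRewardDescentRewardChordBoundRewardedFormSpectrum
import Summits.AtomisticToContinuum.BoseEinsteinCondensation.Theorems.BECRewardDescentRewardChordBoundZeroMomentumOfGroundState
import Literature.MathematicalPhysics.QuantumManyBody.PeriodicMaxFormApproximation
-- module: Summits.AtomisticToContinuum.BoseEinsteinCondensation.Theorems.BECRewardDescentRewardChordBoundRewardedGroundStates

/-!
# Ground states of the REWARDED maximal form of the periodic `N`-boson Hamiltonian: the Beurling–Deny lattice
# (crux `RewardChordBound`, stmt-AtomisticToContinuum-12876, stub 4a `stub_rewardedKyFanGapIntegrable`, helper file F5)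

Rewarded twin of `Literature/…/PeriodicMaxFormGroundStates.lean` for the class
`rewardedGroundStates hL hv hW s = {η ∈ boseSymmetric N | maxFormR s v L η ≤ R(s)‖η‖²}`
(`Literature/…/PeriodicSlotDepletion.lean`; `maxFormR = maxForm + s·dep`, `dep = N - n̂₀` the zero-mode
depletion, `R(s) = rewardedGroundStateEnergy` the rewarded variational ground-state energy), `s ≥ 0`,
`W ∈ L¹` of the cell:

* `rewardedGroundStateEnergy_mul_le_maxFormR` — **the rewarded maximal-form bound** `R(s)‖η‖² ≤ maxFormR η` on
  the Bose sector (the tree's `exists_trialState_maxForm_approx` + the `L²`-Lipschitz bound of the depletion,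
  `…ZeroMomentumOfGroundState.rewardedEnergy_le_maxFormR_add`); hence `maxFormR = R‖η‖²` on the class and the
  class is a `ℂ`-subspace (`add_mem_rewardedGroundStates`, parallelogram law of `maxFormR`);
* `compLp_mem_rewardedGroundStates` — **Beurling–Deny for the rewarded form**: `1`-Lipschitz maps of the values
  fixing `0` and preserving moduli map rewarded ground states to rewarded ground states — the kinetic part and
  the DEPLETION (`tsum_slotWeight_comp_le_of_one`, the Markov property of the one-slot depletion,
  `Literature/…/TorusSlotShiftDirichlet.lean`) do not increase, the potential part and the norm are preserved;
  whence closure under `|·|`, `conj`, `re`, `im`, `(·)⁺`, `(·)⁻`;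
* `graphEmbedding_mem_rewardedGroundStates_of_gramOp_eq` — **bridge**: the images of the top eigenvectors of
  the Gram operator of the rewarded compact embedding (helper file F4) are rewarded ground states.

References: [ReedSimonIV1978] §XIII.12, Thms XIII.43–44, XIII.50; [FarisSimon1975]; [Simon1979Forms].
-/

noncomputable section

open MeasureTheory Filter Set Complex UnitAddTorus
open scoped ENNReal NNReal Topology InnerProductSpace ComplexConjugate
open Literature.Analysis.FunctionSpaces Literature.Analysis.OperatorTheory Literature.Analysis.InnerProduct

namespace Summit.AtomisticToContinuum.BoseEinsteinCondensation.Cruxes.RewardChordBound.Birth.RewardedGroundStates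

open Literature.MathematicalPhysics.QuantumManyBody.BoseGas
open Summit.AtomisticToContinuum.BoseEinsteinCondensation.Cruxes.RewardChordBound.Birth.RewardedFormSpectrum
open Summit.AtomisticToContinuum.BoseEinsteinCondensation.Cruxes.RewardChordBound.Birth.ZeroMomentumOfGroundState

-- The measure on `ℝ/ℤ` is the Haar PROBABILITY measure, as in `PeriodicFormDomain.lean`.
attribute [local instance] Literature.MathematicalPhysics.QuantumManyBody.BoseGas.formDomain_measureSpace
  Literature.MathematicalPhysics.QuantumManyBody.BoseGas.formDomain_isProbabilityMeasure
  Literature.MathematicalPhysics.QuantumManyBody.BoseGas.formDomain_isProbabilityMeasure_pi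

variable {N : ℕ} {L : ℝ} {v : ℝ → ℝ≥0∞} {s : ℝ}

/-- Local notation for the Hilbert space `L²((ℝ/ℤ)^{3N})`, as in `PeriodicFormDomain.lean`. -/
local notation "L2T " N':max => Lp ℂ 2 (volume : Measure (UnitAddTorus (Fin N' × Fin 3)))

section GroundStates

variable (hL : 0 < L) (hv : Measurable v) (hW : ∫⁻ X in cellN N L, periodicInteraction v L X ≠ ⊤)

/-! ### The rewarded maximal-form bound -/

/-- **The rewarded maximal-form bound, unit classes**: `R(s) ≤ maxFormR s v L η` for a unit Bose-symmetric
`η` (`s ≥ 0`): trial states `Φ_ε` with `periodicEnergy ≤ maxForm η + ε`, `‖ιΦ_ε - η‖ ≤ ε`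
(`exists_trialState_maxForm_approx`) have `rewardedEnergy ≤ maxFormR η + (1 + 2sN)ε`. [cite: Simon1979Forms, Thm. 2.1] -/
theorem rewardedGroundStateEnergy_le_maxFormR_of_norm_eq_one (hs : 0 ≤ s) {η : L2T N} (hη : η ∈ boseSymmetric N)
    (h1 : ‖η‖ = 1) : rewardedGroundStateEnergy hL hv hW s ≤ maxFormR s v L η := by
  by_cases hfin : maxForm v L η = ⊤
  · rw [maxFormR_def, hfin, top_add]
    exact le_top
  refine ENNReal.le_of_forall_pos_le_add fun ε hε _ => ?_
  have hc : 0 < 1 + 2 * s * N := by positivity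
  have hε' : 0 < (ε : ℝ) / (1 + 2 * s * N) := div_pos (by exact_mod_cast hε) hc
  obtain ⟨Φ, hE, hdist⟩ := exists_trialState_maxForm_approx hL hv hW hv hW η h1 hη hfin hε'
  calc rewardedGroundStateEnergy hL hv hW s ≤ rewardedEnergy hL hv hW s Φ := rewardedGroundStateEnergy_le hL hv hW s Φ
    _ ≤ maxFormR s v L η + ENNReal.ofReal ((1 + 2 * s * N) * ((ε : ℝ) / (1 + 2 * s * N))) :=
        rewardedEnergy_le_maxFormR_add hL hv hW hs η h1 Φ hε'.le hE hdist
    _ = maxFormR s v L η + ε := by rw [mul_div_cancel₀ _ hc.ne', ENNReal.ofReal_coe_nnreal]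

/-- **The rewarded maximal-form bound**: `R(s) ‖η‖² ≤ maxFormR s v L η` on the Bose sector (`s ≥ 0`).
[cite: Simon1979Forms, Thm. 2.1] -/
theorem rewardedGroundStateEnergy_mul_le_maxFormR (hs : 0 ≤ s) {η : L2T N} (hη : η ∈ boseSymmetric N) :
    rewardedGroundStateEnergy hL hv hW s * ENNReal.ofReal (‖η‖ ^ 2) ≤ maxFormR s v L η := by
  by_cases h0 : η = 0
  · rw [h0, norm_zero, sq, mul_zero, ENNReal.ofReal_zero, mul_zero]
    exact bot_le
  have hn : 0 < ‖η‖ := norm_pos_iff.2 h0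
  set ξ : L2T N := ((‖η‖⁻¹ : ℝ) : ℂ) • η with hξdef
  clear_value ξ
  have hξ1 : ‖ξ‖ = 1 := by
    rw [hξdef, norm_smul, Complex.norm_real, Real.norm_of_nonneg (inv_nonneg.2 hn.le), inv_mul_cancel₀ hn.ne']
  have hξ : ξ ∈ boseSymmetric N := by
    rw [hξdef]
    exact (boseSymmetric N).smul_mem _ hη
  have h := rewardedGroundStateEnergy_le_maxFormR_of_norm_eq_one hL hv hW hs hξ hξ1
  have hηξ : η = ((‖η‖ : ℝ) : ℂ) • ξ := by
    rw [hξdef, smul_smul, ← Complex.ofReal_mul, mul_inv_cancel₀ hn.ne', Complex.ofReal_one, one_smul]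
  calc rewardedGroundStateEnergy hL hv hW s * ENNReal.ofReal (‖η‖ ^ 2)
      ≤ maxFormR s v L ξ * ENNReal.ofReal (‖η‖ ^ 2) := mul_le_mul' h le_rfl
    _ = maxFormR s v L (((‖η‖ : ℝ) : ℂ) • ξ) := by
        rw [maxFormR_smul, Complex.norm_real, Real.norm_of_nonneg hn.le, mul_comm]
    _ = maxFormR s v L η := by rw [← hηξ]

/-- On the rewarded ground-state class the bound is an equality: `maxFormR η = R(s)‖η‖²`. [folklore] -/
theorem maxFormR_eq_of_mem_rewardedGroundStates (hs : 0 ≤ s) {η : L2T N} (hη : η ∈ rewardedGroundStates hL hv hW s) :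
    maxFormR s v L η = rewardedGroundStateEnergy hL hv hW s * ENNReal.ofReal (‖η‖ ^ 2) :=
  le_antisymm hη.2 (rewardedGroundStateEnergy_mul_le_maxFormR hL hv hW hs hη.1)

/-- Rewarded ground states have finite rewarded maximal form (when `R(s) < ∞`). [folklore] -/
theorem maxFormR_ne_top_of_mem (hR : rewardedGroundStateEnergy hL hv hW s ≠ ⊤) {η : L2T N}
    (hη : η ∈ rewardedGroundStates hL hv hW s) : maxFormR s v L η ≠ ⊤ :=
  ne_top_of_le_ne_top (ENNReal.mul_ne_top hR ENNReal.ofReal_ne_top) hη.2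

/-- Rewarded ground states have finite maximal form. [folklore] -/
theorem maxForm_ne_top_of_mem (hR : rewardedGroundStateEnergy hL hv hW s ≠ ⊤) {η : L2T N}
    (hη : η ∈ rewardedGroundStates hL hv hW s) : maxForm v L η ≠ ⊤ :=
  ne_top_of_le_ne_top (maxFormR_ne_top_of_mem hL hv hW hR hη) (by rw [maxFormR_def]; exact le_self_add)

/-- Rewarded ground states have finite kinetic energy. [folklore] -/
theorem maxFormKin_ne_top_of_mem (hR : rewardedGroundStateEnergy hL hv hW s ≠ ⊤) {η : L2T N}
    (hη : η ∈ rewardedGroundStates hL hv hW s) : maxFormKin L η ≠ ⊤ :=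
  ne_top_of_le_ne_top (maxForm_ne_top_of_mem hL hv hW hR hη) (self_le_add_right _ _)

/-- Rewarded ground states have finite potential energy. [folklore] -/
theorem maxFormPot_ne_top_of_mem (hR : rewardedGroundStateEnergy hL hv hW s ≠ ⊤) {η : L2T N}
    (hη : η ∈ rewardedGroundStates hL hv hW s) : maxFormPot v L η ≠ ⊤ :=
  ne_top_of_le_ne_top (maxForm_ne_top_of_mem hL hv hW hR hη) (self_le_add_left _ _)

/-! ### The rewarded ground-state class is a subspace -/

/-- `0` is a rewarded ground state. [folklore] -/
theorem zero_mem_rewardedGroundStates (s : ℝ) : (0 : L2T N) ∈ rewardedGroundStates hL hv hW s :=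
  ⟨(boseSymmetric N).zero_mem, by rw [maxFormR_zero]; exact bot_le⟩

/-- The rewarded ground-state class is closed under scalars. [folklore] -/
theorem smul_mem_rewardedGroundStates (c : ℂ) {η : L2T N} (hη : η ∈ rewardedGroundStates hL hv hW s) :
    c • η ∈ rewardedGroundStates hL hv hW s := by
  refine ⟨(boseSymmetric N).smul_mem c hη.1, ?_⟩
  rw [maxFormR_smul, norm_smul, mul_pow, ENNReal.ofReal_mul (sq_nonneg _), mul_left_comm]
  exact mul_le_mul' le_rfl hη.2

/-- The rewarded ground-state class is closed under negation. [folklore] -/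
theorem neg_mem_rewardedGroundStates {η : L2T N} (hη : η ∈ rewardedGroundStates hL hv hW s) :
    -η ∈ rewardedGroundStates hL hv hW s := by
  have h := smul_mem_rewardedGroundStates hL hv hW (-1 : ℂ) hη
  rwa [neg_one_smul] at h

/-- **The rewarded ground-state class is closed under addition** (`s ≥ 0`, `R(s) < ∞`): parallelogram law of
`maxFormR` and the rewarded maximal-form bound for `η - ξ`. [folklore] -/
theorem add_mem_rewardedGroundStates (hs : 0 ≤ s) (hR : rewardedGroundStateEnergy hL hv hW s ≠ ⊤)
    {η ξ : L2T N} (hη : η ∈ rewardedGroundStates hL hv hW s) (hξ : ξ ∈ rewardedGroundStates hL hv hW s) :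
    η + ξ ∈ rewardedGroundStates hL hv hW s := by
  set E := rewardedGroundStateEnergy hL hv hW s with hEdef
  refine ⟨(boseSymmetric N).add_mem hη.1 hξ.1, ?_⟩
  have hlow : E * ENNReal.ofReal (‖η - ξ‖ ^ 2) ≤ maxFormR s v L (η - ξ) :=
    rewardedGroundStateEnergy_mul_le_maxFormR hL hv hW hs ((boseSymmetric N).sub_mem hη.1 hξ.1)
  have hsum : maxFormR s v L (η + ξ) + maxFormR s v L (η - ξ) ≤
      E * ENNReal.ofReal (‖η + ξ‖ ^ 2) + E * ENNReal.ofReal (‖η - ξ‖ ^ 2) := by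
    rw [maxFormR_parallelogram hs hv]
    calc 2 * maxFormR s v L η + 2 * maxFormR s v L ξ
        ≤ 2 * (E * ENNReal.ofReal (‖η‖ ^ 2)) + 2 * (E * ENNReal.ofReal (‖ξ‖ ^ 2)) := by
          gcongr
          · exact hη.2
          · exact hξ.2
      _ = E * ENNReal.ofReal (2 * ‖η‖ ^ 2 + 2 * ‖ξ‖ ^ 2) := by
          rw [ENNReal.ofReal_add (by positivity) (by positivity), ENNReal.ofReal_mul zero_le_two,
            ENNReal.ofReal_mul zero_le_two, ENNReal.ofReal_ofNat]
          ring
      _ = E * ENNReal.ofReal (‖η + ξ‖ ^ 2 + ‖η - ξ‖ ^ 2) := by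
          congr 1
          congr 1
          have h := parallelogram_law_with_norm ℂ η ξ
          simp only [sq]
          linarith [h]
      _ = E * ENNReal.ofReal (‖η + ξ‖ ^ 2) + E * ENNReal.ofReal (‖η - ξ‖ ^ 2) := by
          rw [ENNReal.ofReal_add (sq_nonneg _) (sq_nonneg _), mul_add]
  have hfin : E * ENNReal.ofReal (‖η - ξ‖ ^ 2) ≠ ⊤ := ENNReal.mul_ne_top hR ENNReal.ofReal_ne_top
  calc maxFormR s v L (η + ξ)
      = maxFormR s v L (η + ξ) + E * ENNReal.ofReal (‖η - ξ‖ ^ 2) - E * ENNReal.ofReal (‖η - ξ‖ ^ 2) :=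
        (ENNReal.add_sub_cancel_right hfin).symm
    _ ≤ maxFormR s v L (η + ξ) + maxFormR s v L (η - ξ) - E * ENNReal.ofReal (‖η - ξ‖ ^ 2) :=
        tsub_le_tsub_right (add_le_add le_rfl hlow) _
    _ ≤ E * ENNReal.ofReal (‖η + ξ‖ ^ 2) + E * ENNReal.ofReal (‖η - ξ‖ ^ 2) - E * ENNReal.ofReal (‖η - ξ‖ ^ 2) :=
        tsub_le_tsub_right hsum _
    _ = E * ENNReal.ofReal (‖η + ξ‖ ^ 2) := ENNReal.add_sub_cancel_right hfin

/-- The rewarded ground-state class is closed under subtraction. [folklore] -/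
theorem sub_mem_rewardedGroundStates (hs : 0 ≤ s) (hR : rewardedGroundStateEnergy hL hv hW s ≠ ⊤)
    {η ξ : L2T N} (hη : η ∈ rewardedGroundStates hL hv hW s) (hξ : ξ ∈ rewardedGroundStates hL hv hW s) :
    η - ξ ∈ rewardedGroundStates hL hv hW s := by
  rw [sub_eq_add_neg]
  exact add_mem_rewardedGroundStates hL hv hW hs hR hη (neg_mem_rewardedGroundStates hL hv hW hξ)

end GroundStates

/-! ### Beurling–Deny for the rewarded form: Lipschitz maps of the values -/

section Lipschitz

variable {Φ : ℂ → ℂ}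

/-- **The Markov property of the depletion, one slot**: `‖(1 - Pᵢ)(Φ ∘ η)‖² ≤ ‖(1 - Pᵢ)η‖²` for a
`1`-Lipschitz `Φ : ℂ → ℂ` with `Φ 0 = 0` (`tsum_slotWeight_comp_le_of_one`). [cite: ReedSimonIV1978, Thm XIII.51] -/
theorem norm_exciteProj_compLp_sq_le (hΦ : LipschitzWith 1 Φ) (h0 : Φ 0 = 0) (i : Fin N) (η : L2T N) :
    ‖exciteProj N i (hΦ.compLp h0 η)‖ ^ 2 ≤ ‖exciteProj N i η‖ ^ 2 := by
  have h := tsum_slotWeight_comp_le_of_one hΦ h0 (Lp.memLp η) i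
  have hl : ENNReal.ofReal (‖exciteProj N i (hΦ.compLp h0 η)‖ ^ 2) = ∑' n : Fin N × Fin 3 → ℤ,
      (if (fun k => n (i, k)) = 0 then 0 else 1) *
        ‖mFourierCoeff (Φ ∘ (η : UnitAddTorus (Fin N × Fin 3) → ℂ)) n‖ₑ ^ 2 := by
    rw [ofReal_norm_exciteProj_sq]
    refine tsum_congr fun n => ?_
    rw [mFourierCoeff_compLp hΦ h0 η n]
    split_ifs
    · rw [zero_mul]
    · rw [one_mul]
  have hr : ENNReal.ofReal (‖exciteProj N i η‖ ^ 2) = ∑' n : Fin N × Fin 3 → ℤ,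
      (if (fun k => n (i, k)) = 0 then 0 else 1) * ‖mFourierCoeff (η : UnitAddTorus (Fin N × Fin 3) → ℂ) n‖ₑ ^ 2 := by
    rw [ofReal_norm_exciteProj_sq]
    refine tsum_congr fun n => ?_
    split_ifs
    · rw [zero_mul]
    · rw [one_mul]
  rw [← hl, ← hr] at h
  exact (ENNReal.ofReal_le_ofReal_iff (sq_nonneg _)).1 h

/-- **The Markov property of the depletion**: `dep(Φ ∘ η) ≤ dep η` for a `1`-Lipschitz `Φ` with `Φ 0 = 0`.
[cite: ReedSimonIV1978, Thm XIII.51] -/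
theorem depletion_compLp_le (hΦ : LipschitzWith 1 Φ) (h0 : Φ 0 = 0) (η : L2T N) :
    depletion N (hΦ.compLp h0 η) ≤ depletion N η := by
  rw [depletion_def, depletion_def]
  exact Finset.sum_le_sum fun i _ => norm_exciteProj_compLp_sq_le hΦ h0 i η

/-- `1`-Lipschitz maps of the values that do not increase moduli do not increase the rewarded maximal form
(`s ≥ 0`). [cite: ReedSimonIV1978, Thm XIII.50 (b) and Thm XIII.51] -/
theorem maxFormR_compLp_le (hs : 0 ≤ s) (hΦ : LipschitzWith 1 Φ) (h0 : Φ 0 = 0) (hle : ∀ z, ‖Φ z‖ ≤ ‖z‖)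
    (v : ℝ → ℝ≥0∞) (L : ℝ) (η : L2T N) : maxFormR s v L (hΦ.compLp h0 η) ≤ maxFormR s v L η := by
  rw [maxFormR_def, maxFormR_def, maxForm, maxForm]
  exact add_le_add (add_le_add (maxFormKin_compLp_le_of_one hΦ h0 η) (maxFormPot_compLp_le hΦ h0 hle η))
    (ENNReal.ofReal_le_ofReal (mul_le_mul_of_nonneg_left (depletion_compLp_le hΦ h0 η) hs))

variable (hL : 0 < L) (hv : Measurable v) (hW : ∫⁻ X in cellN N L, periodicInteraction v L X ≠ ⊤)

/-- **Beurling–Deny at the level of the rewarded maximal form**: a `1`-Lipschitz map of the values fixing `0`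
and preserving moduli (`|·|`, complex conjugation) maps rewarded ground states to rewarded ground states
(`s ≥ 0`). [cite: ReedSimonIV1978, Thm XIII.43 (c)⇒(a) and Thm XIII.50 (b)] -/
theorem compLp_mem_rewardedGroundStates (hs : 0 ≤ s) (hΦ : LipschitzWith 1 Φ) (h0 : Φ 0 = 0)
    (heq : ∀ z, ‖Φ z‖ = ‖z‖) {η : L2T N} (hη : η ∈ rewardedGroundStates hL hv hW s) :
    (hΦ.compLp h0 η : L2T N) ∈ rewardedGroundStates hL hv hW s := by
  refine ⟨compLp_mem_boseSymmetric hΦ h0 hη.1, ?_⟩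
  rw [norm_compLp_eq hΦ h0 heq]
  exact (maxFormR_compLp_le hs hΦ h0 (fun z => (heq z).le) v L η).trans hη.2

/-- **`|η|` is a rewarded ground state if `η` is.** [cite: ReedSimonIV1978, Thm XIII.43 (c)⇒(a)] -/
theorem absLp_mem_rewardedGroundStates (hs : 0 ≤ s) {η : L2T N} (hη : η ∈ rewardedGroundStates hL hv hW s) :
    absLp η ∈ rewardedGroundStates hL hv hW s :=
  compLp_mem_rewardedGroundStates hL hv hW hs _ _ (fun z => by simp) hη

/-- **`conj η` is a rewarded ground state if `η` is** (the rewarded form is real). [cite: ReedSimonIV1978, Thm XIII.43] -/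
theorem conjLp_mem_rewardedGroundStates (hs : 0 ≤ s) {η : L2T N} (hη : η ∈ rewardedGroundStates hL hv hW s) :
    conjLp η ∈ rewardedGroundStates hL hv hW s :=
  compLp_mem_rewardedGroundStates hL hv hW hs _ _ (fun z => by simp) hη

/-- **Real and imaginary parts of rewarded ground states are rewarded ground states** (`R(s) < ∞`).
[cite: ReedSimonIV1978, Thm XIII.43] -/
theorem reLp_mem_rewardedGroundStates (hs : 0 ≤ s) (hR : rewardedGroundStateEnergy hL hv hW s ≠ ⊤)
    {η : L2T N} (hη : η ∈ rewardedGroundStates hL hv hW s) : reLp η ∈ rewardedGroundStates hL hv hW s := by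
  rw [reLp_eq]
  exact smul_mem_rewardedGroundStates hL hv hW _
    (add_mem_rewardedGroundStates hL hv hW hs hR hη (conjLp_mem_rewardedGroundStates hL hv hW hs hη))

/-- Imaginary parts of rewarded ground states are rewarded ground states (`R(s) < ∞`).
[cite: ReedSimonIV1978, Thm XIII.43] -/
theorem imLp_mem_rewardedGroundStates (hs : 0 ≤ s) (hR : rewardedGroundStateEnergy hL hv hW s ≠ ⊤)
    {η : L2T N} (hη : η ∈ rewardedGroundStates hL hv hW s) : imLp η ∈ rewardedGroundStates hL hv hW s := by
  rw [imLp_eq]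
  exact smul_mem_rewardedGroundStates hL hv hW _
    (sub_mem_rewardedGroundStates hL hv hW hs hR hη (conjLp_mem_rewardedGroundStates hL hv hW hs hη))

/-- **Positive parts of REAL rewarded ground states are rewarded ground states** (`R(s) < ∞`):
`η⁺ = ½(|η| + η)`. [cite: ReedSimonIV1978, Thm XIII.43 (c)⇒(a)] -/
theorem posPartLp_mem_rewardedGroundStates (hs : 0 ≤ s) (hR : rewardedGroundStateEnergy hL hv hW s ≠ ⊤)
    {η : L2T N} (hη : η ∈ rewardedGroundStates hL hv hW s) (hreal : conjLp η = η) :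
    posPartLp η ∈ rewardedGroundStates hL hv hW s := by
  rw [posPartLp_eq_of_conjLp_eq hreal]
  exact smul_mem_rewardedGroundStates hL hv hW _
    (add_mem_rewardedGroundStates hL hv hW hs hR (absLp_mem_rewardedGroundStates hL hv hW hs hη) hη)

/-- Negative parts of REAL rewarded ground states are rewarded ground states (`R(s) < ∞`):
`η⁻ = ½(|η| - η)`. [cite: ReedSimonIV1978, Thm XIII.43 (c)⇒(a)] -/
theorem negPartLp_mem_rewardedGroundStates (hs : 0 ≤ s) (hR : rewardedGroundStateEnergy hL hv hW s ≠ ⊤)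
    {η : L2T N} (hη : η ∈ rewardedGroundStates hL hv hW s) (hreal : conjLp η = η) :
    negPartLp η ∈ rewardedGroundStates hL hv hW s := by
  rw [negPartLp_eq_of_conjLp_eq hreal]
  exact smul_mem_rewardedGroundStates hL hv hW _
    (sub_mem_rewardedGroundStates hL hv hW hs hR (absLp_mem_rewardedGroundStates hL hv hW hs hη) hη)

end Lipschitz

/-! ### The bridge to the rewarded closed form (helper file F4) -/

section Bridge

variable (hL : 0 < L) (hv : Measurable v) (hW : ∫⁻ X in cellN N L, periodicInteraction v L X ≠ ⊤)

/-- Real arithmetic of the bridge: if `c = κ(a + g)` with `0 < κ ≤ 1`, `0 ≤ g`, `c ≤ a`, then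
`(a - c) + g = (κ⁻¹ - 1)c` in `ℝ≥0∞`. [folklore] -/
theorem ofReal_sub_add_ofReal_eq_of_eq_mul_add {κ a g c : ℝ} (hκ : 0 < κ) (hκ1 : κ ≤ 1) (hg : 0 ≤ g)
    (hca : c ≤ a) (hc : c = κ * (a + g)) :
    ENNReal.ofReal (a - c) + ENNReal.ofReal g = ENNReal.ofReal (κ⁻¹ - 1) * ENNReal.ofReal c := by
  have hk : 0 ≤ κ⁻¹ - 1 := sub_nonneg.2 ((one_le_inv₀ hκ).2 hκ1)
  rw [← ENNReal.ofReal_add (sub_nonneg.2 hca) hg, ← ENNReal.ofReal_mul hk]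
  congr 1
  have hag : a + g = κ⁻¹ * c := by
    rw [hc, ← mul_assoc, inv_mul_cancel₀ hκ.ne', one_mul]
  linear_combination hag

/-- **Bridge: eigenvectors of the rewarded Gram operator for its top eigenvalue are rewarded ground states.**
If `u` lies in the rewarded form domain (the graph of `rewardG s`) with `gramOp ι_s u = κ₁ u` for the rewarded
embedding `ι_s = graphEmbedding ι (rewardG s)` and a rewarded `TwoModeData d`, then `ι_s u ∈ rewardedGroundStates`
(`maxForm (ιψ) ≤ ‖ψ‖²_Q - ‖ιψ‖²`, `maxForm_formEmbed_le`, plus `‖rewardG s ψ‖² = s·dep(ιψ)` and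
`‖ιψ‖² = κ₁(‖ψ‖²_Q + ‖rewardG s ψ‖²)`, `R(s) = κ₁⁻¹ - 1`). [cite: ReedSimonIV1978, Thm. XIII.1 and XIII.64] -/
theorem graphEmbedding_mem_rewardedGroundStates_of_gramOp_eq (hs : 0 ≤ s)
    (d : TwoModeData (graphEmbedding (formEmbed hL hv hW) (rewardG hL hv hW s)))
    {u : graphSpace (rewardG hL hv hW s)}
    (hu : gramOp (graphEmbedding (formEmbed hL hv hW) (rewardG hL hv hW s)) u = (d.κ₁ : ℂ) • u) :
    graphEmbedding (formEmbed hL hv hW) (rewardG hL hv hW s) u ∈ rewardedGroundStates hL hv hW s := by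
  rw [graphEmbedding_apply (formEmbed hL hv hW) (rewardG hL hv hW s) u]
  have h3 := TwoModeData.norm_map_fst_sq_of_gramOp_eq hu
  generalize (u : WithLp 2 (formDomain hL hv hW × PiLp 2 (fun _ : Fin N => L2T N))).fst = ψ at h3 ⊢
  refine ⟨formEmbed_mem_boseSymmetric hL hv hW ψ, ?_⟩
  have h1 : maxForm v L (formEmbed hL hv hW ψ) ≤ ENNReal.ofReal (‖ψ‖ ^ 2 - ‖formEmbed hL hv hW ψ‖ ^ 2) :=
    maxForm_formEmbed_le hL hv hW ψ
  have h2 : ‖rewardG hL hv hW s ψ‖ ^ 2 = s * depletion N (formEmbed hL hv hW ψ) := norm_rewardG_sq hL hv hW hs ψ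
  have h4 : ‖formEmbed hL hv hW ψ‖ ≤ ‖ψ‖ := norm_formEmbed_le hL hv hW ψ
  have hca : ‖formEmbed hL hv hW ψ‖ ^ 2 ≤ ‖ψ‖ ^ 2 := pow_le_pow_left₀ (norm_nonneg _) h4 2
  have key := ofReal_sub_add_ofReal_eq_of_eq_mul_add d.κ₁_pos (twoModeData_reward_κ₁_le_one d) (sq_nonneg _) hca h3
  rw [rewardedGroundStateEnergy_eq_ofReal hs d, ← key, maxFormR_def, ← h2]
  exact add_le_add h1 le_rfl

end Bridge

end Summit.AtomisticToContinuum.BoseEinsteinCondensation.Cruxes.RewardChordBound.Birth.RewardedGroundStates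

namespace Summit.AtomisticToContinuum.BoseEinsteinCondensation.Cruxes.RewardChordBound.Birth

open Summit.AtomisticToContinuum.BoseEinsteinCondensation.Cruxes.RewardChordBound.Birth.RewardedGroundStates
  Literature.MathematicalPhysics.QuantumManyBody.BoseGas

/-- **Registered sub-goal of stub `stub_rewardedKyFanGapIntegrable` (helper file F5): the rewarded ground-state
class is a cone of Bose-symmetric classes closed under addition, `|·|` and complex conjugation** (`s ≥ 0`,
`R(s) < ∞`). [cite: ReedSimonIV1978, Thm XIII.43 and Thm XIII.50] -/
theorem stub_rewardedKyFanGapIntegrable_RewardedGroundStates :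
    ∀ (N : ℕ) (L : ℝ) (v : ℝ → ENNReal) (hL : 0 < L) (hv : Measurable v) (hW : (∫⁻ X in Literature.MathematicalPhysics.QuantumManyBody.BoseGas.cellN N L, Literature.MathematicalPhysics.QuantumManyBody.BoseGas.periodicInteraction v L X) ≠ ⊤) (s : ℝ), 0 ≤ s → Literature.MathematicalPhysics.QuantumManyBody.BoseGas.rewardedGroundStateEnergy hL hv hW s ≠ ⊤ → ∀ η ξ : MeasureTheory.Lp ℂ 2 (MeasureTheory.Measure.pi fun _ : Fin N × Fin 3 => (AddCircle.haarAddCircle : MeasureTheory.Measure UnitAddCircle)), η ∈ Literature.MathematicalPhysics.QuantumManyBody.BoseGas.rewardedGroundStates hL hv hW s → ξ ∈ Literature.MathematicalPhysics.QuantumManyBody.BoseGas.rewardedGroundStates hL hv hW s → (η + ξ ∈ Literature.MathematicalPhysics.QuantumManyBody.BoseGas.rewardedGroundStates hL hv hW s ∧ Literature.MathematicalPhysics.QuantumManyBody.BoseGas.absLp η ∈ Literature.MathematicalPhysics.QuantumManyBody.BoseGas.rewardedGroundStates hL hv hW s ∧ Literature.MathematicalPhysics.QuantumManyBody.BoseGas.conjLp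 η ∈ Literature.MathematicalPhysics.QuantumManyBody.BoseGas.rewardedGroundStates hL hv hW s) :=
  fun _ _ _ hL hv hW _ hs hR _ _ hη hξ =>
    ⟨add_mem_rewardedGroundStates hL hv hW hs hR hη hξ, absLp_mem_rewardedGroundStates hL hv hW hs hη,
      conjLp_mem_rewardedGroundStates hL hv hW hs hη⟩

end Summit.AtomisticToContinuum.BoseEinsteinCondensation.Cruxes.RewardChordBound.Birth

end
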